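import Mathlib
import HarnessLib
import Summits.PneNP.PneNP.Theses.Circuit
import Literature.Computability.Complexity.CircuitLowerBounds
import Literature.Computability.Complexity.CircuitSizeProofs

/-!
# Crux `CircuitSuperlinear` (stmt-PneNP-0036) — line `Sketch` (Karchmer–Wigderson linear representations)

Skeleton owned by the line lead (prover-line-stmt-PneNP-0036-0), reconstructed from the crux-ideate
card `Cruxes/CircuitSuperlinear/Ideas/kw-linear-representation.md` and Karchmer–Wigderson,
*Characterizing non-deterministic circuit size*, STOC 1993 [KarchmerWigderson1993], §2 (Thm. 1–2)
and §5 (Def. 9, Thm. 7). The planner's `Sketch.lean` evidence file is not mounted in this seat; the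
composition below is the card's `circuitSuperlinear_of_linRep : KWTransfer → LinRepSuperlinear →
CircuitSuperlinear`, with two corrections found while re-deriving it:

* KW's `σ_t` is `y₁ ∧ ⋀_{i=1}^{t} (y_{2i} ∨ y_{2i+1})` — DISJOINT pairs, one per covering subspace
  `H(Aⁱ, Bⁱ)` of the proof of Thm. 2/7 (the printed "`(y₂ ∨ y₃) ∧ (y₃ ∨ y₄) ∧ ⋯`" is a typo the card
  copied). We model `GF(2)^{2t+1}` as `ZMod 2 × (Fin t → ZMod 2 × ZMod 2)` (coordinate `y₁` = `.1`,
  pair `i` = `.2 i`), so `σ_t(y) ⟺ y.1 = 1 ∧ ∀ i, y.2 i ≠ 0` needs no index arithmetic.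
* The card's bound `t ≤ 2 · circuitSizeOver B2 f` is false for projections `z ↦ z i` (size `0`,
  and no representation of dimension `1` exists); the correct deterministic bound is
  `t ≤ 2 · size + 1` (two pairs per gate, one pair for the output wire), proved directly from the
  straight-line program without `Ω_f` (lead's NOTES.md, "KW direct construction").

Stubs (registered): `stub_kwTransfer` (KW93 Thm. 7 with Thm. 1, deterministic case; TRUE, being
formalised) and `stub_linRepSuperlinear` (the card's transfer target C⁺: some NP language has no
linear representation of dimension `O(n)` infinitely often — OPEN, formally at least as strong as
the crux). `CircuitSuperlinear_of` concludes the crux by name from the two stubs.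
-/

set_option linter.dupNamespace false -- `Summit.PneNP.PneNP.…`: summit = sub-problem name (D-0017)

namespace Summit.PneNP.PneNP.Cruxes.CircuitSuperlinear.Sketch

open Filter Literature.Computability.Complexity Literature.Computability.Complexity.Nondeterministic

/-- **Stub 1 (Karchmer–Wigderson 1993, Thm. 7 with Thm. 1; deterministic case, per circuit).** The
function computed by a `B₂`-circuit `C` on `n` inputs affords a linear representation of dimension
`2t+1` with `t = 2 · C.size + 1`: there are a linear map `P : GF(2)ⁿ → GF(2)^{2t+1}` and a subspace `Q`
such that `C(z) = 0 ⟺ P z ∈ Q ⊕ σ_t⁻¹(1)`, where `σ_t(y) = y₁ ∧ ⋀ᵢ (y_{2i} ∨ y_{2i+1})`; here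
`GF(2)^{2t+1}` is written `ZMod 2 × (Fin t → ZMod 2 × ZMod 2)` (two pairs per gate encode the gate
equation `w = p·q + r` over `GF(2)`, one pair encodes "output wire = 0").
[cite: KarchmerWigderson1993, Thm. 7 and Thm. 1] -/
theorem stub_kwTransfer :
    ∀ (n : ℕ) (C : Circuit (Fin n)), C.IsOver B2 →
      ∃ (P : (Fin n → ZMod 2) →ₗ[ZMod 2] (ZMod 2 × (Fin (2 * C.size + 1) → ZMod 2 × ZMod 2)))
        (Q : Submodule (ZMod 2) (ZMod 2 × (Fin (2 * C.size + 1) → ZMod 2 × ZMod 2))),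
        ∀ z : Fin n → Bool, C.eval z = false ↔
          ∃ q ∈ Q, (P (boolOfZMod2 z) + q).1 = 1 ∧
            ∀ j : Fin (2 * C.size + 1), (P (boolOfZMod2 z) + q).2 j ≠ 0 := by
  sorry

/-- From Stub 1 to the card's `KWTransfer` form: every `f` affords a linear representation with
dimension parameter `t ≤ 2 · circuitSizeOver B2 f + 1` (the infimum is attained because every
Boolean function on `Fin n` has a `B₂`-circuit, `cktSize_univ`). [cite: KarchmerWigderson1993, Thm. 7] -/
theorem kwTransfer_size (n : ℕ) (f : (Fin n → Bool) → Bool) :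
    ∃ t ≤ 2 * circuitSizeOver B2 f + 1,
      ∃ (P : (Fin n → ZMod 2) →ₗ[ZMod 2] (ZMod 2 × (Fin t → ZMod 2 × ZMod 2)))
        (Q : Submodule (ZMod 2) (ZMod 2 × (Fin t → ZMod 2 × ZMod 2))),
        ∀ z : Fin n → Bool, f z = false ↔
          ∃ q ∈ Q, (P (boolOfZMod2 z) + q).1 = 1 ∧ ∀ j : Fin t, (P (boolOfZMod2 z) + q).2 j ≠ 0 := by
  obtain ⟨C₀, hB₀, -, hC₀⟩ := (cktSize_univ fun (x : Fin n → Bool) (_ : Unit) => f x).toCircuit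
  obtain ⟨C, hB, hC, hs⟩ := exists_circuit_size_eq_circuitSizeOver (B := B2) (f := f) ⟨C₀, hB₀, fun x => hC₀ x⟩
  obtain ⟨P, Q, hrep⟩ := stub_kwTransfer n C hB
  refine ⟨2 * C.size + 1, by omega, P, Q, fun z => ?_⟩
  rw [← hC z]
  exact hrep z

/-- **Stub 2 (the transfer target C⁺ of the card, `LinRepSuperlinear`).** Some language in `NP`
has slices without linear representations of linear dimension, infinitely often: for every `c`,
frequently in `n`, no `t ≤ c · n` admits `P, Q` representing the slice `L ∩ {0,1}ⁿ` as above
(equivalently: its co-nondeterministic `∧`-complexity is not `O(n)`). OPEN — at least as strong as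
the crux; the best known explicit bounds of this type stop at `n` [cite: KarchmerWigderson1993, §5
(Characterization 4)]. -/
theorem stub_linRepSuperlinear :
    ∃ L ∈ NP, ∀ c : ℕ, ∃ᶠ n in atTop, ∀ t ≤ c * n,
      ¬ ∃ (P : (Fin n → ZMod 2) →ₗ[ZMod 2] (ZMod 2 × (Fin t → ZMod 2 × ZMod 2)))
          (Q : Submodule (ZMod 2) (ZMod 2 × (Fin t → ZMod 2 × ZMod 2))),
          ∀ z : Fin n → Bool, L.sliceFn n z = false ↔
            ∃ q ∈ Q, (P (boolOfZMod2 z) + q).1 = 1 ∧ ∀ j : Fin t, (P (boolOfZMod2 z) + q).2 j ≠ 0 := by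
  sorry

/-- **Composition (the card's `circuitSuperlinear_of_linRep`, constants adjusted):** the two stubs
give the crux `CircuitSuperlinear` BY NAME. If the slice of `L` at a length `n ≥ 1` had circuit
complexity `≤ c·n`, Stub 1 would give a representation of dimension parameter
`t ≤ 2cn + 1 ≤ (2c+2)·n`, contradicting Stub 2 at the constant `2c+2`. [folklore] -/
theorem CircuitSuperlinear_of : Summit.PneNP.PneNP.Theses.Circuit.CircuitSuperlinear := by
  obtain ⟨L, hL, hsup⟩ := stub_linRepSuperlinear
  refine ⟨L, hL, fun c => ?_⟩
  refine ((hsup (2 * c + 2)).and_eventually (eventually_ge_atTop 1)).mono fun n hn => ?_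
  obtain ⟨hno, hn1⟩ := hn
  by_contra hle
  rw [not_lt] at hle
  obtain ⟨t, ht, P, Q, hrep⟩ := kwTransfer_size n (L.sliceFn n)
  have hsz : circuitSizeOver B2 (L.sliceFn n) = L.circuitSize n := rfl
  rw [hsz] at ht
  have h3 : (2 * c + 2) * n = 2 * (c * n) + 2 * n := by ring
  exact hno t (by omega) ⟨P, Q, hrep⟩

end Summit.PneNP.PneNP.Cruxes.CircuitSuperlinear.Sketch
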